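import Summits.Ventures.HodgeRepro2.T6A3Model
import Summits.Ventures.HodgeRepro2.T6A3Detect
import Summits.Ventures.HodgeRepro2.T6A3PairingKappa

/-!
# T6-A3 — `A3_main`: Theorem A over the interface (TIER4 §A5–§A6 in kernel)

Tier 6 (README §10), sub-goal A3, seat t6-p3; proof lane.  THE A3 MAIN THEOREM over
`T6Interface` (lead's contract, STATUS ll. 4259 / 4346): from the period input (N) and the
A1 / A2 outputs, the Weil projection `p_W(y)` of the algebraic class `y = z ⋆ θ⁴` is a NON-ZERO
algebraic element of the rational split Weil line — the ∃-form that A1's `A1_lineHit` turns into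
`WeilClassesAlgebraic D` (LINE-HIT, TIER4 §A3.2 / §A6).

Inputs (binders of `A3_main`; contract posted STATUS l. 4379):
* `E : EigenBasis K` — A1 (C1): the embeddings enumerated by (real place, conjugation bit) and an
  eigenvector basis of `H¹(B, ℂ)` spanning the interface's eigenlines;
* `pW` — A1 (C2): the rational Weil projector `p_W : H^*(B, ℚ) → H^*(B, ℚ)`, with values in the Weil
  line `weilQ K` and preserving the algebraic classes `D.Alg 2` (Prop. A2.3(ii)/(iii));
* `hpW_C` — A1 (C3): its complex form is the MODEL Weil projector `modelWeilProj` (the six Weil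
  coordinates kept, every other monomial coordinate killed; Prop. A2.3(i)), read through the
  eigenbasis model `modelEquiv E` of `T6A3Model`;
* `θ, c` — A2 (S2): the F-compatible algebraic class `θ ∈ Alg¹(B)` whose complex form is
  `Σ_p c_p E_p` with every `c_p ≠ 0` (TIER4 §A4.2);
* `PeriodInputN D` — (N), the interface's display.

The proof is TIER4 §A5–§A6 step by step, each step a landed file:
(N) ⟹ some model Weil vector `w_σ` has `∫_S f^* w_σ ≠ 0` (`weilC_eq`) ⟹ `⟨y, θ⁸ ∪ w_σ⟩ ≠ 0`
(`pair_ne_zero_of_period_ne_zero_kappa`, fed by `T6A3BaseChange` / `T6A3IntegralModel`) ⟹ the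
`w_σ̄`-coordinate of `y` is non-zero (`integral_mul_theta_pow_mul_weil`) ⟹ `modelWeilProj y ≠ 0` ⟹
`p_W y ≠ 0` (`hpW_C`); and `p_W y ∈ weilQ K ∩ D.Alg 2`.  Nothing here is a display.
-/

open scoped TensorProduct

namespace Summit.Ventures.HodgeRepro2.T6.A3Main

open WeilPlanes WeilIntegral WeilDetect WeilCoproduct A3ExtBC A3BaseChange A3IntegralModel A3Detect
  A3Model A3Pairing A3PairingKappa

variable {K : Type*} [Field K] [NumberField K]

/-! ## 1. The Künneth map of the model into `HBBC K` -/

/-- `hbcEquiv⁻¹ (ι w) = ι (h1Equiv⁻¹ w)`. -/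
theorem hbcEquiv_symm_ι (w : H1C K) :
    (hbcEquiv K).symm (ExteriorAlgebra.ι ℂ w) = ExteriorAlgebra.ι ℂ ((h1Equiv K).symm w) := by
  rw [AlgEquiv.symm_apply_eq, hbcEquiv_ι, LinearEquiv.apply_symm_apply]

/-- `hbcEquiv⁻¹` is graded. -/
theorem hbcEquiv_symm_mem_exteriorPower (n : ℕ) (y : HBC K) (hy : y ∈ ⋀[ℂ]^n (H1C K)) :
    (hbcEquiv K).symm y ∈ ⋀[ℂ]^n (ℂ ⊗[ℚ] H1 K) := by
  rw [← ExteriorAlgebra.ιMulti_span_fixedDegree] at hy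
  induction hy using Submodule.span_induction with
  | mem x hx =>
    obtain ⟨w, rfl⟩ := hx
    have : (hbcEquiv K).symm (ExteriorAlgebra.ιMulti ℂ n w) =
        ExteriorAlgebra.ιMulti ℂ n (fun i => (h1Equiv K).symm (w i)) := by
      rw [ExteriorAlgebra.ιMulti_apply, ExteriorAlgebra.ιMulti_apply, map_list_prod, List.map_ofFn]
      exact congrArg List.prod (congrArg List.ofFn (funext fun i => hbcEquiv_symm_ι (w i)))
    rw [this]
    exact ExteriorAlgebra.ιMulti_range ℂ n ⟨_, rfl⟩
  | zero => simp
  | add x y _ _ hx hy => rw [map_add]; exact Submodule.add_mem _ hx hy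
  | smul r x _ hx => rw [map_smul]; exact Submodule.smul_mem _ r hx

variable (E : EigenBasis K)

/-- The Koszul anticommutation of `pr₁^* ∘ Φ` and `pr₂^* ∘ Φ` in `HBBC K`. -/
theorem anticommutes_model :
    ∀ ⦃i j : ℕ⦄ (a : grading Pl i) (b : grading Pl j),
      ((inlC K).comp (modelEquiv E).toAlgHom) a * ((inrC K).comp (modelEquiv E).toAlgHom) b =
        (-1 : ℤˣ) ^ (j * i) •
          (((inrC K).comp (modelEquiv E).toAlgHom) b * ((inlC K).comp (modelEquiv E).toAlgHom) a) := by
  intro i j a b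
  simp only [AlgHom.comp_apply]
  change inlC K (modelEquiv E a) * inrC K (modelEquiv E b) =
    (-1 : ℤˣ) ^ (j * i) • (inrC K (modelEquiv E b) * inlC K (modelEquiv E a))
  unfold inlC inrC
  simp only [AlgHom.comp_apply]
  change GradedTensorProduct.includeLeft (gradS ℚ ℂ (H1 K)) (gradS ℚ ℂ (H1 K))
      ((hbcEquiv K).symm (modelEquiv E a)) *
    GradedTensorProduct.includeRight (gradS ℚ ℂ (H1 K)) (gradS ℚ ℂ (H1 K))
      ((hbcEquiv K).symm (modelEquiv E b)) =
    (-1 : ℤˣ) ^ (j * i) • (GradedTensorProduct.includeRight (gradS ℚ ℂ (H1 K)) (gradS ℚ ℂ (H1 K))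
      ((hbcEquiv K).symm (modelEquiv E b)) *
      GradedTensorProduct.includeLeft (gradS ℚ ℂ (H1 K)) (gradS ℚ ℂ (H1 K))
        ((hbcEquiv K).symm (modelEquiv E a)))
  rw [GradedTensorProduct.includeLeft_apply, GradedTensorProduct.includeRight_apply]
  have ha : (hbcEquiv K).symm (modelEquiv E a) ∈ gradS ℚ ℂ (H1 K) i :=
    hbcEquiv_symm_mem_exteriorPower i _ (modelEquiv_mem_exteriorPower E i a a.2)
  have hb : (hbcEquiv K).symm (modelEquiv E b) ∈ gradS ℚ ℂ (H1 K) j :=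
    hbcEquiv_symm_mem_exteriorPower j _ (modelEquiv_mem_exteriorPower E j b b.2)
  have h1 := GradedTensorProduct.tmul_coe_mul_coe_tmul (gradS ℚ ℂ (H1 K)) (gradS ℚ ℂ (H1 K))
    ((hbcEquiv K).symm (modelEquiv E a)) (⟨1, SetLike.one_mem_graded _⟩ : gradS ℚ ℂ (H1 K) 0)
    (⟨1, SetLike.one_mem_graded _⟩ : gradS ℚ ℂ (H1 K) 0) ((hbcEquiv K).symm (modelEquiv E b))
  have h2 := GradedTensorProduct.tmul_coe_mul_coe_tmul (gradS ℚ ℂ (H1 K)) (gradS ℚ ℂ (H1 K))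
    (1 : ExteriorAlgebra ℂ (ℂ ⊗[ℚ] H1 K)) (⟨_, hb⟩ : gradS ℚ ℂ (H1 K) j)
    (⟨_, ha⟩ : gradS ℚ ℂ (H1 K) i) (1 : ExteriorAlgebra ℂ (ℂ ⊗[ℚ] H1 K))
  simp only [mul_zero, uzpow_zero, one_smul, mul_one, one_mul] at h1 h2
  rw [h1, h2, smul_smul, Int.units_mul_self, one_smul]

/-- The Künneth algebra map `κ : AA Pl →ₐ[ℂ] HBBC K`, `x ⊗ y ↦ pr₁^* (Φ x) ∪ pr₂^* (Φ y)`. -/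
noncomputable def kappa : AA Pl →ₐ[ℂ] HBBC K :=
  GradedTensorProduct.lift (grading Pl) (grading Pl) ((inlC K).comp (modelEquiv E).toAlgHom)
    ((inrC K).comp (modelEquiv E).toAlgHom) (anticommutes_model E)

/-- `κ` is a Künneth map for the eigenbasis model. -/
theorem isKunneth_kappa : IsKunneth (modelEquiv E) (inlC K) (inrC K) (kappa E) := by
  constructor
  · intro x
    unfold kappa WeilCoproduct.inl
    rw [GradedTensorProduct.includeLeft_apply, GradedTensorProduct.lift_tmul]
    simp only [AlgHom.comp_apply, map_one, mul_one]
    rfl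
  · intro y
    unfold kappa WeilCoproduct.inr
    rw [GradedTensorProduct.includeRight_apply, GradedTensorProduct.lift_tmul]
    simp only [AlgHom.comp_apply, map_one, one_mul]
    rfl

/-! ## 2. The six Weil index sets and the model Weil projector -/

/-- The six Weil index sets of the model (the monomials `w_{(ν, s)}`). -/
noncomputable def weilSet : Finset (Finset (Fin (Fintype.card (Gen Pl)))) :=
  Finset.univ.image fun νs : Fin 3 × Bool => weilIdx (planes νs.1) νs.2

/-- Each Weil index set belongs to `weilSet`. -/
theorem weilIdx_mem_weilSet (ν : Fin 3) (s : Bool) : weilIdx (planes ν) s ∈ weilSet :=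
  Finset.mem_image.mpr ⟨(ν, s), Finset.mem_univ _, rfl⟩

/-! ## 3. `A3_main` -/

variable {F : FaceSetting K} (D : TransferShadow F)

/-- `θ ∈ Alg¹ ⟹ θ⁴ ∈ Alg⁴` (`cl` is a ring homomorphism, `D.alg_mul`). -/
theorem theta_pow_four_mem_alg {θ : HB K} (hθ : θ ∈ D.Alg 1) : θ ^ 4 ∈ D.Alg 4 := by
  have h2 : θ ^ 2 ∈ D.Alg 2 := by
    rw [pow_two]
    exact D.alg_mul hθ hθ
  have h4 : θ ^ 2 * θ ^ 2 ∈ D.Alg (2 + 2) := D.alg_mul h2 h2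
  rwa [← pow_add] at h4

/-- `y = z ⋆ θ⁴ ∈ Alg²(B)` (TIER4 (S3): `D.alg_pont` with `z ∈ Alg¹⁰`, `θ⁴ ∈ Alg⁴`, `10 + 4 − 12 = 2`). -/
theorem pont_z_theta_mem_alg {θ : HB K} (hθ : θ ∈ D.Alg 1) : D.pont D.z (θ ^ 4) ∈ D.Alg 2 := by
  have := D.alg_pont D.z_alg (theta_pow_four_mem_alg D hθ)
  simpa using this

/-- A ℂ-linear functional non-zero somewhere on the span of a family is non-zero at a member of
the family. -/
theorem exists_ne_zero_of_mem_span {M : Type*} [AddCommGroup M] [Module ℂ M] (f : M →ₗ[ℂ] ℂ)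
    {ι' : Type*} (g : ι' → M) {w : M} (hw : w ∈ Submodule.span ℂ (Set.range g)) (hne : f w ≠ 0) :
    ∃ i, f (g i) ≠ 0 := by
  by_contra hcon
  have hall : ∀ i, f (g i) = 0 := fun i => by_contra fun h => hcon ⟨i, h⟩
  have hle : Submodule.span ℂ (Set.range g) ≤ LinearMap.ker f := by
    rw [Submodule.span_le]
    rintro _ ⟨i, rfl⟩
    exact hall i
  exact hne (hle hw)

/-- **A3_main — Theorem A's A3 content over the interface.**  Under the A1 inputs (the eigenbasis
`E`, the Weil projector `pW` with its complex form `modelWeilProj`), the A2 input (`θ ∈ Alg¹` with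
complex coefficients `c_p ≠ 0`) and THE PERIOD INPUT (N), the Weil projection of the algebraic class
`y = z ⋆ θ⁴` is a non-zero algebraic element of the rational split Weil line
(`A1_lineHit` then gives `WeilClassesAlgebraic D`). -/
theorem A3_main (E : EigenBasis K) (pW : HB K →ₗ[ℚ] HB K) (hpW_weil : ∀ v, pW v ∈ weilQ K)
    (hpW_alg : ∀ v ∈ D.Alg 2, pW v ∈ D.Alg 2)
    (hpW_C : ∀ v ∈ degB K 4, extC K (pW v) =
      modelEquiv E (modelWeilProj weilSet ((modelEquiv E).symm (extC K v))))
    (θ : HB K) (hθalg : θ ∈ D.Alg 1) (c : Pl → ℂ) (hc : ∀ p, c p ≠ 0)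
    (hθ : extC K θ = modelEquiv E (theta c)) (hN : PeriodInputN D) :
    ∃ w ∈ weilQ K, w ≠ 0 ∧ w ∈ D.Alg 2 := by
  -- the algebraic class y = z ⋆ θ⁴ and its Weil projection
  set yℚ : HB K := D.pont D.z (θ ^ 4) with hyℚ
  have hyalg : yℚ ∈ D.Alg 2 := pont_z_theta_mem_alg D hθalg
  refine ⟨pW yℚ, hpW_weil yℚ, ?_, hpW_alg yℚ hyalg⟩
  -- (N): some model Weil vector has a non-zero period
  obtain ⟨w, hw, hwne⟩ := hN
  rw [weilC_eq E] at hw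
  obtain ⟨⟨ν, s⟩, hνs⟩ := exists_ne_zero_of_mem_span (D.intS ∘ₗ D.pull.toLinearMap) _ hw hwne
  simp only [LinearMap.comp_apply, AlgHom.toLinearMap_apply] at hνs
  -- the pairing identity: ⟨y, θ⁸ ∪ w_σ⟩ ≠ 0
  have hP₀ : (planes ν).card = 4 := card_planes ν
  have hpair := pair_ne_zero_of_period_ne_zero_kappa (modelEquiv E) (inlC K) (inrC K) (copC K)
    (kappa E) (intBC D) (intBBC D) D.intS D.pull (extC K D.z) (extC K yℚ) c (volB D (modelEquiv E))
    (isKunneth_kappa E)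
    (fun v => by rw [modelEquiv_ι, copC_ι])
    (fun a b => intBBC_inlC_mul_inrC D a b)
    (integralModel D (modelEquiv E) card_Pl (modelEquiv_mem_exteriorPower E)
      (modelEquiv_symm_mem_exteriorPower E))
    (fun u => by rw [hyℚ, pont_spec_C D, map_pow, hθ])
    (fun u => z_proj_C D u) hc (planes ν) s hP₀ hνs
  -- the integral of the model: the w_σ̄-coordinate of y is non-zero
  set v : A Pl := (modelEquiv E).symm (extC K yℚ) with hv
  have hy : extC K yℚ = modelEquiv E v := by rw [hv, AlgEquiv.apply_symm_apply]
  rw [hy, ← map_mul, (integralModel D (modelEquiv E) card_Pl (modelEquiv_mem_exteriorPower E)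
    (modelEquiv_symm_mem_exteriorPower E)).2] at hpair
  have hint : integral (v * (theta c ^ (Finset.univ \ planes ν).card * weil (planes ν) s)) ≠ 0 :=
    right_ne_zero_of_mul hpair
  obtain ⟨ε, hε, hdet⟩ := integral_mul_theta_pow_mul_weil c (planes ν) s hP₀ v
  rw [hdet] at hint
  have hcoord : (monoBasis Pl).repr v (weilIdx (planes ν) !s) ≠ 0 := by
    intro h0
    apply hint
    rw [h0, mul_zero, mul_zero]
  -- hence the Weil projection of y is non-zero, hence p_W y ≠ 0
  intro hpW0
  have hydeg : yℚ ∈ degB K 4 := by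
    have h := D.alg_deg 2 hyalg
    simpa using h
  have hC := hpW_C yℚ hydeg
  rw [hpW0, map_zero, ← hv] at hC
  have hproj : modelWeilProj weilSet v = 0 := by
    have := congrArg (modelEquiv E).symm hC
    rw [map_zero, AlgEquiv.symm_apply_apply] at this
    exact this.symm
  exact hcoord (repr_eq_zero_of_weilProj_eq_zero weilSet v hproj (weilIdx_mem_weilSet ν (!s)))


/-! ## 4. The dictionary from A2's form of `θ` to the model's `theta c` -/

/-- A2's (S2) writes the complex form of `θ` as `Σ_i Σ_ν c i ν • ι(single i a_ν) * ι(single i b_ν)` with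
`a_ν, b_ν ∈ K ⊗ ℂ` the eigenvectors of the two embeddings of the real place `ν`; when the eigenbasis
`E` is made of these vectors (`eB (i, emb (ν, false)) = single i a_ν`, `eB (i, emb (ν, true)) = single i b_ν`)
that sum IS `modelEquiv E (theta c')` with `c' (i, ν) = c i ν` — the `hθ` binder of `A3_main`. -/
theorem theta_eq_of_eigenBasis (a b : Fin 3 → KC K)
    (ha : ∀ (i : Fin 4) (ν : Fin 3), E.eB (i, E.emb (ν, false)) =
      LinearMap.single ℂ (fun _ : Fin 4 => KC K) i (a ν))
    (hb : ∀ (i : Fin 4) (ν : Fin 3), E.eB (i, E.emb (ν, true)) =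
      LinearMap.single ℂ (fun _ : Fin 4 => KC K) i (b ν))
    (c : Fin 4 → Fin 3 → ℂ) :
    ∑ i : Fin 4, ∑ ν : Fin 3, c i ν •
        (ExteriorAlgebra.ι ℂ (LinearMap.single ℂ (fun _ : Fin 4 => KC K) i (a ν)) *
          ExteriorAlgebra.ι ℂ (LinearMap.single ℂ (fun _ : Fin 4 => KC K) i (b ν))) =
      modelEquiv E (theta fun p : Pl => c p.1 p.2) := by
  unfold theta
  rw [map_sum, Fintype.sum_prod_type]
  refine Finset.sum_congr rfl fun i _ => Finset.sum_congr rfl fun ν _ => ?_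
  rw [map_smul]
  congr 1
  unfold WeilPlanes.E
  rw [map_mul, modelEquiv_gen, modelEquiv_gen]
  have h0 : genIdx E ((i, ν), false) = (i, E.emb (ν, false)) := rfl
  have h1 : genIdx E ((i, ν), true) = (i, E.emb (ν, true)) := rfl
  rw [h0, h1, ha, hb]

end Summit.Ventures.HodgeRepro2.T6.A3Main
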